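import Literature.Barriers.CriticalPhenomena.PlaquetteWalkStraightRuns
import Literature.Barriers.CriticalPhenomena.PlaquetteWalkHoleRootRowLaw
import HarnessLib

/-!
# Barrier catalogue (SAWScalingLimit): a wound class-`B2a` walk of limit cost `5` does not return to its TOP ROW («B2a MEMBERS LIVE ON THE ROOT ROW», I)

`Z → ∞` limit model of the printed Yang–Baxter weights [GlazmanManolescu2019, §1, eq. (1)]; the «RECTANGLE COEFFICIENT» line of the venture lane «pcv-sawmu»
(b-engine-1 g26), first half of FINDING-YB-LEVEL5-PHASE-LAW §3 RESULT 1 (in the census the class-`B2a` members of limit cost `5` occur ONLY at root-row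
rhombi). ★★★ `ΩG.not_top_row_of_cost_five`: a wound class-`B2a` walk of limit cost `5` from the hole root `w.side W` at a rhombus `r` with `w.1 ≤ r.1`
never has `r` in its topmost row. Proof by the CHAIN CALCULUS of `PlaquetteWalkKissChains` plus ONE parity count: the turn profile (#824) leaves two
top-row turns `T₁, T₂`, the bottom row `Y'` and one middle isolated turn `τ`, which the east chain of the first turn puts on the root row; the vertical
chains below `T₁`, `T₂` and the last plaquette `c = (r.1, r.2 − 1)` end at bottom-row turns or at `τ`; if `τ` sits under `c` the walk climbs from its first
turn straight to `c` and ends before reaching `r`; if `τ` sits under `T₂` the first turn is the doubly visited plaquette `κ₀ = (r.1, w.2)`, and either the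
walk again climbs straight to `c`, or it descends and is then forced along `κ₀ → B_c → B₁ → T₁ → r` through straight cells — crossing the root row at the
single plaquette `(X, w.2)` BEFORE the first hit of `r`, so the excursion never crosses the western ray behind `w` and the winding functional `AJ`
vanishes (#838 parity law), against woundness.
[GlazmanManolescu2019 §1 Fig. 1, eq. (1), Lemma 2.1, Remark 2.2; Glazman2015WeightedSAW Lemma 3.1 (proof, pp. 6–7); CourantRobbins1958 Ch. V App. §2]
-/

noncomputable section

namespace Literature.Probability.RandomPlanarGeometry.SAW.YangBaxter

open Real
open Literature.Barriers.CriticalPhenomena.PlaquetteWalk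

open private fc_fh fh_add_Mv three_le_Mv from Literature.Probability.RandomPlanarGeometry.YangBaxterSAWGeneralDomain

namespace ΩG

open private side_jOut from Literature.Probability.RandomPlanarGeometry.YangBaxterSAWExcursionJordan
open private sIn_succ_of_sOut_N sIn_succ_of_sOut_S from Literature.Barriers.CriticalPhenomena.PlaquetteWalkHoleRootRowLaw

variable {D : Set Face} {w r : Face} {ω : ΩG D (w.side .W) r}

/-! ## A wound cost-`5` walk does not return to a rhombus of its top row -/

/-- ★★★ **NO RETURN TO THE TOP ROW AT LIMIT COST `5`.** A wound class-`B2a` walk of limit cost `5` from the hole root `w.side W` (hole absent) at a rhombus `r`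
with `w.1 ≤ r.1` does not have `r` in its topmost row. [cite: GlazmanManolescu2019, §1, Fig. 1 and eq. (1); Lemma 2.1; Remark 2.2]
[cite: Glazman2015WeightedSAW, Lemma 3.1 (proof, pp. 6–7)] [cite: CourantRobbins1958, Ch. V Appendix §2 (the even–odd rule)] -/
theorem not_top_row_of_cost_five (hh : holeFaceW w ∉ D) (hr : RootedFace D (w.side .W) r) (h : ω.IsB2a)
    (hA : ω.AJ hr h (toC (midPt (w.side .W))) ≠ 0) (hc : cost (slotOfSide ω.1) ω.2.mids = 5) (hcol : w.1 ≤ r.1)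
    (htop : ∀ j < ω.2.arcs.length, (ω.2.fc j).2 ≤ r.2) : False := by
  classical
  set n := ω.2.arcs.length with hn
  ---------------------------------------------------------------- basics (as in `injective_of_cost_five`)
  have hz := end_slanted_of_cost_five hh hr h hA hc
  have hd : slotDeg (slotOfSide ω.1) = 1 := by rcases hz with e | e <;> rw [e] <;> rfl
  have hF := ω.fh_lt h
  have hlen : 0 < n := by omega
  have h0w : ω.2.fc 0 = w := fc_zero_eq_root w hh ω.2 hlen
  have h0W : ω.2.sIn 0 = .W := YBWalk.sIn_zero_eq_W hh ω.2 hlen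
  have h0E : ω.2.sIn 0 ≠ .E := by rw [h0W]; decide
  have h0N : ω.2.sIn 0 ≠ .N := by rw [h0W]; decide
  have h0S : ω.2.sIn 0 ≠ .S := by rw [h0W]; decide
  have hlast := sOut_last_NS_of_slanted h hz
  have hzE : ω.2.sOut (n - 1) ≠ .E := by rcases hlast with e | e <;> rw [e] <;> decide
  have hzW : ω.2.sOut (n - 1) ≠ .W := by rcases hlast with e | e <;> rw [e] <;> decide
  have hlastr := fc_last_ne_root hr h
  have hfcF := (fc_fh ω hr h).1
  have hsvr : ∀ l < n, ω.2.fc l = ω.2.fc ω.2.firstHitG → l = ω.2.firstHitG := fun l hl e => eq_firstHitG_of_fc_eq hr h hl e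
  have hfne3 : ω.2.firstHitG + 3 ≤ n := by have := three_le_Mv hr h; have := fh_add_Mv h; unfold ΩG.Mv at *; omega
  have hzside : (ω.2.fc (n - 1)).side (ω.2.sOut (n - 1)) = r.side ω.1 := by
    obtain ⟨-, hout⟩ := ω.2.side_sIn_eq_nth (show n - 1 < n by omega)
    rwa [show n - 1 + 1 = n by omega, ω.2.nth_length] at hout
  -- profile
  obtain ⟨Y₀, Y', hY'w, hY₀w, hY₀, hY', hprof, T₀, -, hT₀, -, hT₀row, -, hT₀card, -⟩ := turn_profile_of_cost_five hh hr h hA hc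
  have hYr : Y₀ = r.2 := by
    obtain ⟨f, hf⟩ : T₀.Nonempty := by rw [← Finset.card_pos, hT₀card]; omega
    obtain ⟨m, hm, hfm⟩ := ω.2.exists_fc_eq_of_mem_facesL (hT₀ f hf).1
    have h1 := htop m hm; rw [hfm, hT₀row f hf] at h1
    have h2 := hY₀ _ hF; rw [hfcF] at h2
    omega
  subst hYr
  have hY : ∀ j < n, (ω.2.fc j).2 ≤ r.2 := htop
  have hYw : w.2 < r.2 := hY₀w
  have h5 := (isolated_eq_five_of_cost_five hh hr h hA hc).1
  let P : Face → Prop := fun f => f ∈ facesL ω.2.mids ∧ (kindsL ω.2.mids f = [.corner] ∨ kindsL ω.2.mids f = [.coCorner])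
  have hPiso : ∀ k < n, (∀ l < n, ω.2.fc l = ω.2.fc k → l = k) → arcKind (ω.2.sIn k) (ω.2.sOut k) ≠ .straight → P (ω.2.fc k) :=
    fun k hk hsv hkind => isolated_turn hk hsv hkind
  have hmid1 : ∀ f g, P f → P g → Y' < f.2 → f.2 < r.2 → Y' < g.2 → g.2 < r.2 → f = g := by
    intro f g hf hg h1 h2 h3 h4
    by_contra hne
    have := (hprof {f, g} (fun x hx => by
      simp only [Finset.mem_insert, Finset.mem_singleton] at hx
      rcases hx with rfl | rfl
      · exact hf
      · exact hg)).2.2 (fun x hx => by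
      simp only [Finset.mem_insert, Finset.mem_singleton] at hx
      rcases hx with rfl | rfl
      · exact ⟨h1, h2⟩
      · exact ⟨h3, h4⟩)
    rw [Finset.card_insert_of_notMem (by simpa using hne), Finset.card_singleton, hd] at this
    omega
  have hrow3 : ∀ f g k : Face, P f → P g → P k → f ≠ g → f ≠ k → g ≠ k →
      ¬(f.2 = r.2 ∧ g.2 = r.2 ∧ k.2 = r.2) ∧ ¬(f.2 = Y' ∧ g.2 = Y' ∧ k.2 = Y') := by
    intro f g k hf hg hk h1 h2 h3
    have hT : ∀ x ∈ ({f, g, k} : Finset Face), P x := by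
      intro x hx; simp only [Finset.mem_insert, Finset.mem_singleton] at hx
      rcases hx with rfl | rfl | rfl
      · exact hf
      · exact hg
      · exact hk
    have hcard : ({f, g, k} : Finset Face).card = 3 := by
      rw [Finset.card_insert_of_notMem (by simp [h1, h2]), Finset.card_insert_of_notMem (by simp [h3]), Finset.card_singleton]
    constructor
    · rintro ⟨e1, e2, e3⟩
      have := (hprof {f, g, k} hT).1 (fun x hx => by
        simp only [Finset.mem_insert, Finset.mem_singleton] at hx
        rcases hx with rfl | rfl | rfl <;> assumption)
      omega
    · rintro ⟨e1, e2, e3⟩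
      have := (hprof {f, g, k} hT).2.1 (fun x hx => by
        simp only [Finset.mem_insert, Finset.mem_singleton] at hx
        rcases hx with rfl | rfl | rfl <;> assumption)
      omega
  have hNtop := forall_top_ne_N hh hr h hY hYw
  have hSbot := forall_bottom_ne_S hh hr h hY' hY'w
  obtain ⟨X', -, hX', -⟩ := exists_right_entry_turn hh hr h
  ---------------------------------------------------------------- the end: `ω.1 = S`, last plaquette `c = (r.1, r.2 − 1)` left through `N`
  have hrside : ∀ s, ω.2.UsesSide r s → r.side s ≠ r.side ω.1 := by
    rintro s ⟨l, hl, hfl, hs⟩ e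
    have hl' := hsvr l hl (hfl.trans hfcF.symm)
    obtain ⟨hin, hout⟩ := ω.2.side_sIn_eq_nth hl
    rw [hfl] at hin hout
    rw [← ω.2.nth_length] at e
    rcases hs with hs | hs
    · rw [hs] at hin; have := ω.2.nth_inj (show l ≤ n by omega) le_rfl (hin.symm.trans e).symm.symm; omega
    · rw [hs] at hout; have := ω.2.nth_inj (show l + 1 ≤ n by omega) le_rfl (hout.symm.trans e).symm.symm; omega
  obtain ⟨hωS, hsN, hc1⟩ : ω.1 = .S ∧ ω.2.sOut (n - 1) = .N ∧ ω.2.fc (n - 1) = (r.1, r.2 - 1) := by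
    rcases hfc : ω.2.fc (n - 1) with ⟨x, y⟩
    rw [hfc] at hzside hlastr
    have hyY : y ≤ r.2 := by have := hY (n - 1) (by omega); rw [hfc] at this; exact this
    rcases r with ⟨r1, r2⟩
    simp only at hyY hlastr ⊢
    generalize hs : ω.2.sOut (n - 1) = s at hzside hlast ⊢
    generalize ht : ω.1 = t at hzside hz ⊢
    rcases hz with rfl | rfl <;> rcases hlast with rfl | rfl <;>
      simp only [Face.side, MidEdge.slant.injEq, Prod.mk.injEq, reduceCtorEq, false_and, and_false, true_and] at hzside ⊢
    · exact absurd (Prod.ext hzside.1 (by simp only; omega)) hlastr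
    · omega
    · refine ⟨?_, ?_⟩ <;> omega
    · exact absurd (Prod.ext hzside.1 (by simp only; omega)) hlastr
  ---------------------------------------------------------------- the arc of `r`: straight horizontal (a turn would use `S`, the end side)
  obtain ⟨-, hsInF, hsOutF⟩ := fc_fh ω hr h
  have hNr := hNtop _ hF (by rw [hfcF])
  have hrEW : ω.2.UsesSide r .E ∧ ω.2.UsesSide r .W ∧ (∀ i < n, ω.2.fc i = r → ω.2.sIn i ≠ .N ∧ ω.2.sOut i ≠ .N ∧ ω.2.sIn i ≠ .S ∧ ω.2.sOut i ≠ .S) := by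
    have hne := ω.2.sIn_ne_sOut hF
    have hnoS : ¬(ω.2.sIn ω.2.firstHitG = .S ∨ ω.2.sOut ω.2.firstHitG = .S) := by
      intro hs
      exact hrside .S ⟨_, hF, hfcF, hs⟩ (by rw [hωS])
    have key : (ω.2.sIn ω.2.firstHitG = .E ∧ ω.2.sOut ω.2.firstHitG = .W) ∨ (ω.2.sIn ω.2.firstHitG = .W ∧ ω.2.sOut ω.2.firstHitG = .E) := by
      revert hne hnoS hNr
      cases ω.2.sIn ω.2.firstHitG <;> cases ω.2.sOut ω.2.firstHitG <;> decide
    refine ⟨?_, ?_, fun i hi hfi => ?_⟩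
    · rcases key with ⟨e, -⟩ | ⟨-, e⟩
      · exact ⟨_, hF, hfcF, Or.inl e⟩
      · exact ⟨_, hF, hfcF, Or.inr e⟩
    · rcases key with ⟨-, e⟩ | ⟨e, -⟩
      · exact ⟨_, hF, hfcF, Or.inr e⟩
      · exact ⟨_, hF, hfcF, Or.inl e⟩
    · have := hsvr i hi (hfi.trans hfcF.symm); subst this
      rcases key with ⟨e1, e2⟩ | ⟨e1, e2⟩ <;> rw [e1, e2] <;> decide
  obtain ⟨hrE, hrW, hrNS⟩ := hrEW
  have hrN : ¬ω.2.UsesSide r .N := by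
    rintro ⟨i, hi, hfi, hs | hs⟩
    exacts [(hrNS i hi hfi).1 hs, (hrNS i hi hfi).2.1 hs]
  have hrS : ¬ω.2.UsesSide r .S := by
    rintro ⟨i, hi, hfi, hs | hs⟩
    exacts [(hrNS i hi hfi).2.2.1 hs, (hrNS i hi hfi).2.2.2 hs]
  ---------------------------------------------------------------- the top-row turns `T₁ = (r.1 − M₁, r.2)` (uses `E`), `T₂ = (r.1 + M₂, r.2)` (uses `W`)
  obtain ⟨X, hXw, hX, sL, -, hsL, hcolL, -, hinL, houtL⟩ := exists_left_entry_turn hh hr h hA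
  have hsvσ : ∀ l < n, ω.2.fc l = ω.2.fc sL → l = sL :=
    fun l hl e => (left_single_visit hh hr h hX (by omega) hsL hl hcolL e.symm).symm
  have hPσ : P (ω.2.fc sL) := hPiso sL hsL hsvσ (by rw [hinL]; rcases houtL with e | e <;> rw [e] <;> decide)
  have hWleft := forall_left_ne_W hh hr h hX (by omega)
  obtain ⟨M₁, hE₁, hW₁, hend₁⟩ := ω.2.chain_W hX hrW
  obtain ⟨hM₁1, hnotW₁⟩ : 1 ≤ M₁ ∧ ¬ω.2.UsesSide (r.1 - M₁, r.2) .W := by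
    rcases hend₁ with hT | ⟨hA0, -⟩ | ⟨-, hsZ⟩
    · exact hT
    · exfalso; rw [h0w] at hA0; have := congrArg Prod.snd hA0; simp only at this; omega
    · exact absurd hsZ hzW
  obtain ⟨iT₁, hiT₁, hfcT₁, hsvT₁, hET₁, hninT₁, hnoutT₁, hkT₁⟩ := ω.2.isolated_of_usesSide_not_opp (hE₁ M₁ hM₁1 le_rfl) hnotW₁
  have hPT₁ : P (r.1 - M₁, r.2) := by rw [← hfcT₁]; exact hPiso iT₁ hiT₁ hsvT₁ hkT₁
  obtain ⟨M₂, hW₂, hE₂, hend₂⟩ := ω.2.chain_E hX' hrE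
  obtain ⟨hM₂1, hnotE₂⟩ : 1 ≤ M₂ ∧ ¬ω.2.UsesSide (r.1 + M₂, r.2) .E := by
    rcases hend₂ with hT | ⟨-, hs0⟩ | ⟨-, hsZ⟩
    · exact hT
    · exact absurd hs0 h0E
    · exact absurd hsZ hzE
  obtain ⟨iT₂, hiT₂, hfcT₂, hsvT₂, hWT₂, hninT₂, hnoutT₂, hkT₂⟩ := ω.2.isolated_of_usesSide_not_opp (hW₂ M₂ hM₂1 le_rfl) hnotE₂
  have hPT₂ : P (r.1 + M₂, r.2) := by rw [← hfcT₂]; exact hPiso iT₂ hiT₂ hsvT₂ hkT₂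
  -- every top-row isolated turn is `T₁` or `T₂`
  have hrowY : ∀ f, P f → f.2 = r.2 → f = (r.1 - (M₁ : ℤ), r.2) ∨ f = (r.1 + (M₂ : ℤ), r.2) := by
    intro f hf hf2
    by_contra hno
    push Not at hno
    exact (hrow3 _ _ _ hPT₁ hPT₂ hf (by intro e; have := congrArg Prod.fst e; simp only at this; omega) (Ne.symm hno.1) (Ne.symm hno.2)).1
      ⟨rfl, rfl, hf2⟩
  -- `T₁` uses `S` (a top-row turn through `E`, not `W`, not `N`)
  have hT₁S : ω.2.UsesSide (r.1 - M₁, r.2) .S := by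
    have hne := ω.2.sIn_ne_sOut hiT₁
    obtain ⟨hn1, hn2⟩ := hNtop iT₁ hiT₁ (by rw [hfcT₁])
    have key : ω.2.sIn iT₁ = .S ∨ ω.2.sOut iT₁ = .S := by
      revert hET₁ hninT₁ hnoutT₁ hne hn1 hn2 hkT₁
      cases ω.2.sIn iT₁ <;> cases ω.2.sOut iT₁ <;> decide
    exact ⟨iT₁, hiT₁, hfcT₁, key⟩
  have hT₂S : ω.2.UsesSide (r.1 + M₂, r.2) .S := by
    have hne := ω.2.sIn_ne_sOut hiT₂
    obtain ⟨hn1, hn2⟩ := hNtop iT₂ hiT₂ (by rw [hfcT₂])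
    have key : ω.2.sIn iT₂ = .S ∨ ω.2.sOut iT₂ = .S := by
      revert hWT₂ hninT₂ hnoutT₂ hne hn1 hn2 hkT₂
      cases ω.2.sIn iT₂ <;> cases ω.2.sOut iT₂ <;> decide
    exact ⟨iT₂, hiT₂, hfcT₂, key⟩
  ---------------------------------------------------------------- the first turn and the middle turn `τ = (τ1, w.2)`
  obtain ⟨k₁, hk₁, hstr, hturn⟩ := exists_first_turn_of_wound hh hr h hA hc
  obtain ⟨hrun, -⟩ := ω.2.initial_run hh hk₁ hstr
  obtain ⟨hfk, hWk⟩ := hrun k₁ le_rfl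
  have hp₁W : ω.2.UsesSide (w.1 + k₁, w.2) .W := ⟨k₁, hk₁, hfk, Or.inl hWk⟩
  obtain ⟨τ1, hPτ, hτW, hτE, hτalt⟩ : ∃ τ1 : ℤ, P (τ1, w.2) ∧ ω.2.UsesSide (τ1, w.2) .W ∧ ¬ω.2.UsesSide (τ1, w.2) .E ∧
      ((τ1 = w.1 + k₁ ∧ ¬ω.2.UsesSide (w.1 + k₁, w.2) .E) ∨ (w.1 + k₁ < τ1 ∧ ω.2.UsesSide (w.1 + k₁, w.2) .E)) := by
    by_cases hpE : ω.2.UsesSide (w.1 + k₁, w.2) .E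
    · obtain ⟨M, hWall, -, hend⟩ := ω.2.chain_E hX' hpE
      rcases hend with ⟨hM1, hnot⟩ | ⟨-, hs0⟩ | ⟨-, hsZ⟩
      · obtain ⟨i', hi', hfc', hsv', -, -, -, hk'⟩ := ω.2.isolated_of_usesSide_not_opp (hWall M hM1 le_rfl) hnot
        refine ⟨w.1 + k₁ + M, ?_, hWall M hM1 le_rfl, hnot, Or.inr ⟨by omega, hpE⟩⟩
        have := hPiso i' hi' hsv' hk'; rw [hfc'] at this; exact this
      · exact absurd hs0 h0E
      · exact absurd hsZ hzE
    · obtain ⟨i', hi', hfc', hsv', -, -, -, hk'⟩ := ω.2.isolated_of_usesSide_not_opp hp₁W hpE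
      refine ⟨w.1 + k₁, ?_, hp₁W, hpE, Or.inl ⟨rfl, hpE⟩⟩
      have := hPiso i' hi' hsv' hk'; rw [hfc'] at this; exact this
  have hτ1w : w.1 + k₁ ≤ τ1 := by rcases hτalt with ⟨e, -⟩ | ⟨e, -⟩ <;> omega
  obtain ⟨iτ, hiτ, hfcτ, hsvτ, hWτ, hninτ, hnoutτ, hkτ⟩ := ω.2.isolated_of_usesSide_not_opp hτW hτE
  -- every middle isolated turn is `τ`
  have hmidτ : ∀ f, P f → Y' < f.2 → f.2 < r.2 → f = (τ1, w.2) := fun f hf h1 h2 => hmid1 _ _ hf hPτ h1 h2 hY'w hYw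
  -- the left entry turn lies in an extreme row; hence `T₁ = (X, r.2)`
  have hσrow : (ω.2.fc sL).2 = r.2 ∨ (ω.2.fc sL).2 = Y' := by
    have h1 := hY sL hsL; have h2 := hY' sL hsL
    by_contra hno
    push Not at hno
    have := hmidτ _ hPσ (lt_of_le_of_ne h2 (fun e => hno.2 e.symm)) (lt_of_le_of_ne h1 hno.1)
    have := congrArg Prod.fst this; rw [hcolL] at this; simp only at this; omega
  have hT₁X : r.1 - (M₁ : ℤ) = X := by
    rcases hσrow with hσY | hσY'
    · rcases hrowY _ hPσ hσY with e | e
      · have := congrArg Prod.fst e; rw [hcolL] at this; simp only at this; omega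
      · have := congrArg Prod.fst e; rw [hcolL] at this; simp only at this; omega
    · -- `σ` in the bottom row leaves through `N`; its chain climbs to a top-row turn in column `X`
      have hσN : ω.2.sOut sL = .N := by
        rcases houtL with e | e
        · exact e
        · exact absurd e (hSbot sL hsL hσY').2
      obtain ⟨M, hS', -, hend⟩ := ω.2.chain_N hY ⟨sL, hsL, rfl, Or.inr hσN⟩
      rcases hend with ⟨hM1, hnot⟩ | ⟨-, hs0⟩ | ⟨hZ, -⟩
      · obtain ⟨i', hi', hfc', hsv', -, -, -, hk'⟩ := ω.2.isolated_of_usesSide_not_opp (hS' M hM1 le_rfl) hnot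
        have hP' : P ((ω.2.fc sL).1, (ω.2.fc sL).2 + M) := by rw [← hfc']; exact hPiso i' hi' hsv' hk'
        have hle : (ω.2.fc sL).2 + M ≤ r.2 := by have := hY i' hi'; rw [hfc'] at this; exact this
        rcases lt_or_eq_of_le hle with hlt | heq
        · have := hmidτ _ hP' (by simp only; omega) hlt
          have := congrArg Prod.fst this; rw [hcolL] at this; simp only at this; omega
        · rcases hrowY _ hP' heq with e | e
          · have := congrArg Prod.fst e; rw [hcolL] at this; simp only at this; omega
          · have := congrArg Prod.fst e; rw [hcolL] at this; simp only at this; omega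
      · exact absurd hs0 h0N
      · have := congrArg Prod.fst hZ; rw [hc1, hcolL] at this; simp only at this; omega
  -- the column of `T₁ = (X, r.2)` descends to the bottom-row turn `B₁ = (X, Y')`
  obtain ⟨Md₁, hNd₁, hSd₁, hendd₁⟩ := ω.2.chain_S hY' hT₁S
  obtain ⟨hMd₁, hB₁N, hB₁S⟩ : (Md₁ : ℤ) = r.2 - Y' ∧ ω.2.UsesSide (X, Y') .N ∧ ¬ω.2.UsesSide (X, Y') .S := by
    rcases hendd₁ with ⟨hM1, hnot⟩ | ⟨-, hs0⟩ | ⟨-, hsZ⟩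
    · obtain ⟨i', hi', hfc', hsv', -, -, -, hk'⟩ := ω.2.isolated_of_usesSide_not_opp (hNd₁ Md₁ hM1 le_rfl) hnot
      have hP' : P (r.1 - M₁, r.2 - Md₁) := by rw [← hfc']; exact hPiso i' hi' hsv' hk'
      have hge : Y' ≤ r.2 - Md₁ := by have := hY' i' hi'; rw [hfc'] at this; exact this
      rcases lt_or_eq_of_le hge with hlt | heq
      · have := hmidτ _ hP' hlt (by simp only; omega)
        have := congrArg Prod.fst this; simp only at this; omega
      · have eY : r.2 - (Md₁ : ℤ) = Y' := heq.symm
        simp only at hnot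
        refine ⟨by omega, ?_, ?_⟩
        · have := hNd₁ Md₁ hM1 le_rfl; simp only at this; rwa [eY, hT₁X] at this
        · rwa [eY, hT₁X] at hnot
    · exact absurd hs0 h0S
    · rw [hsN] at hsZ; exact absurd hsZ (by decide)
  obtain ⟨iB₁, hiB₁, hfcB₁, hsvB₁, hNB₁, hninB₁, hnoutB₁, hkB₁⟩ := ω.2.isolated_of_usesSide_not_opp hB₁N hB₁S
  have hPB₁ : P (X, Y') := by rw [← hfcB₁]; exact hPiso iB₁ hiB₁ hsvB₁ hkB₁
  ---------------------------------------------------------------- `τ` uses `N` (three bottom turns otherwise)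
  have hτNS : (ω.2.UsesSide (τ1, w.2) .N ∧ ¬ω.2.UsesSide (τ1, w.2) .S) ∨ (ω.2.UsesSide (τ1, w.2) .S ∧ ¬ω.2.UsesSide (τ1, w.2) .N) := by
    have hne := ω.2.sIn_ne_sOut hiτ
    have key : ((ω.2.sIn iτ = .N ∨ ω.2.sOut iτ = .N) ∧ ω.2.sIn iτ ≠ .S ∧ ω.2.sOut iτ ≠ .S) ∨
        ((ω.2.sIn iτ = .S ∨ ω.2.sOut iτ = .S) ∧ ω.2.sIn iτ ≠ .N ∧ ω.2.sOut iτ ≠ .N) := by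
      revert hWτ hninτ hnoutτ hne
      cases ω.2.sIn iτ <;> cases ω.2.sOut iτ <;> decide
    rcases key with ⟨hN, h1, h2⟩ | ⟨hS, h1, h2⟩
    · refine Or.inl ⟨⟨iτ, hiτ, hfcτ, hN⟩, ?_⟩
      rintro ⟨j, hj, hfj, hs⟩
      have := hsvτ j hj (hfj.trans hfcτ.symm); subst this
      rcases hs with hs | hs
      exacts [h1 hs, h2 hs]
    · refine Or.inr ⟨⟨iτ, hiτ, hfcτ, hS⟩, ?_⟩
      rintro ⟨j, hj, hfj, hs⟩
      have := hsvτ j hj (hfj.trans hfcτ.symm); subst this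
      rcases hs with hs | hs
      exacts [h1 hs, h2 hs]
  rcases hτNS with ⟨hτN, hτnS⟩ | ⟨hτS, hτnN⟩
  swap
  · -- `τ` uses `S`: its chain, `T₁`'s and `T₂`'s give three bottom-row turns
    obtain ⟨Mτ, hNτ, -, hendτ⟩ := ω.2.chain_S hY' hτS
    have hBτ : P (τ1, Y') := by
      rcases hendτ with ⟨hM1, hnot⟩ | ⟨-, hs0⟩ | ⟨-, hsZ⟩
      · obtain ⟨i', hi', hfc', hsv', -, -, -, hk'⟩ := ω.2.isolated_of_usesSide_not_opp (hNτ Mτ hM1 le_rfl) hnot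
        have hP' : P (τ1, w.2 - Mτ) := by rw [← hfc']; exact hPiso i' hi' hsv' hk'
        have hge : Y' ≤ w.2 - Mτ := by have := hY' i' hi'; rw [hfc'] at this; exact this
        rcases lt_or_eq_of_le hge with hlt | heq
        · have := hmidτ _ hP' hlt (by simp only; omega)
          have := congrArg Prod.snd this; simp only at this; omega
        · have eY : w.2 - (Mτ : ℤ) = Y' := heq.symm
          rwa [eY] at hP'
      · exact absurd hs0 h0S
      · rw [hsN] at hsZ; exact absurd hsZ (by decide)
    obtain ⟨Md₂, hNd₂, -, hendd₂⟩ := ω.2.chain_S hY' hT₂S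
    have hB₂ : P (r.1 + M₂, Y') ∧ ((τ1 : ℤ) = r.1 + M₂ → ω.2.UsesSide (τ1, w.2) .N) := by
      rcases hendd₂ with ⟨hM1, hnot⟩ | ⟨-, hs0⟩ | ⟨-, hsZ⟩
      · obtain ⟨i', hi', hfc', hsv', -, -, -, hk'⟩ := ω.2.isolated_of_usesSide_not_opp (hNd₂ Md₂ hM1 le_rfl) hnot
        have hP' : P (r.1 + M₂, r.2 - Md₂) := by rw [← hfc']; exact hPiso i' hi' hsv' hk'
        have hge : Y' ≤ r.2 - Md₂ := by have := hY' i' hi'; rw [hfc'] at this; exact this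
        rcases lt_or_eq_of_le hge with hlt | heq
        · -- a middle turn: it is `τ`, which then uses `N`
          have e := hmidτ _ hP' hlt (by simp only; omega)
          have e1 := congrArg Prod.fst e; have e2 := congrArg Prod.snd e; simp only at e1 e2
          have := hNd₂ Md₂ hM1 le_rfl; simp only at this
          rw [e2, e1] at this
          exact absurd this hτnN
        · have eY : r.2 - (Md₂ : ℤ) = Y' := heq.symm
          refine ⟨by rwa [eY] at hP', fun e => ?_⟩
          have := hNd₂ (r.2 - w.2).toNat (by omega) (by omega)
          simp only at this
          rwa [show r.2 - (((r.2 - w.2).toNat : ℕ) : ℤ) = w.2 by omega, ← e] at this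
      · exact absurd hs0 h0S
      · rw [hsN] at hsZ; exact absurd hsZ (by decide)
    obtain ⟨hPB₂, hτne⟩ := hB₂
    have hne3 : (τ1 : ℤ) ≠ r.1 + M₂ := fun e => hτnN (hτne e)
    exact (hrow3 _ _ _ hPB₁ hPB₂ hBτ (by intro e; have := congrArg Prod.fst e; simp only at this; omega)
      (by intro e; have := congrArg Prod.fst e; simp only at this; omega)
      (by intro e; have := congrArg Prod.fst e; simp only at this; omega)).2 ⟨rfl, rfl, rfl⟩
  ---------------------------------------------------------------- `τ` uses `N`: its chain climbs to `T₂` (τ1 = r.1 + M₂) or to the last plaquette (τ1 = r.1)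
  obtain ⟨Mu, hSu, hNu, hendu⟩ := ω.2.chain_N hY hτN
  -- a doubly visited first-turn plaquette has its column chain topped by a top-row turn in its own column: only possible at `(r.1, w.2)`
  have hp₁ : (τ1 = w.1 + k₁ ∧ ¬ω.2.UsesSide (w.1 + k₁, w.2) .E) ∨
      (w.1 + (k₁ : ℤ) = r.1 ∧ w.1 + k₁ < τ1 ∧ ∀ s, ω.2.UsesSide (w.1 + k₁, w.2) s) := by
    rcases hτalt with hA' | ⟨hτlt, hpE⟩
    · exact Or.inl hA'
    · have hp2 : ∀ s, ω.2.UsesSide (w.1 + k₁, w.2) s := by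
        obtain ⟨j, hj, hfj, hjE⟩ := hpE
        have hne : k₁ ≠ j := by
          rintro rfl
          have hk := hturn; rw [hWk] at hk
          rcases hjE with e | e
          · rw [hWk] at e; exact absurd e (by decide)
          · rw [e] at hk; exact hk rfl
        intro s; rw [← hfk]; exact ω.2.usesSide_of_fc_eq hk₁ hj hne (hfk.trans hfj.symm) s
      refine Or.inr ⟨?_, hτlt, hp2⟩
      obtain ⟨M, hS', -, hend⟩ := ω.2.chain_N hY (hp2 .N)
      rcases hend with ⟨hM1, hnot⟩ | ⟨-, hs0⟩ | ⟨hZ, -⟩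
      · obtain ⟨i', hi', hfc', hsv', -, -, -, hk'⟩ := ω.2.isolated_of_usesSide_not_opp (hS' M hM1 le_rfl) hnot
        have hP' : P (w.1 + k₁, w.2 + M) := by rw [← hfc']; exact hPiso i' hi' hsv' hk'
        have hle : w.2 + M ≤ r.2 := by have := hY i' hi'; rw [hfc'] at this; exact this
        exfalso
        rcases lt_or_eq_of_le hle with hlt' | heq
        · have := hmidτ _ hP' (by simp only; omega) hlt'
          have := congrArg Prod.fst this; simp only at this; omega
        · rcases hrowY _ hP' heq with e | e
          · have := congrArg Prod.fst e; simp only at this; omega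
          · have e1 := congrArg Prod.fst e; simp only at e1
            -- then `τ1 > r.1 + M₂`, but `τ`'s own chain tops at `(τ1, r.2) ∈ {T₁, T₂}` or at `c` (column `r.1`): all columns `≤ r.1 + M₂`
            rcases hendu with ⟨hMu1, hnot'⟩ | ⟨-, hs0⟩ | ⟨hZ, -⟩
            · obtain ⟨i'', hi'', hfc'', hsv'', -, -, -, hk''⟩ := ω.2.isolated_of_usesSide_not_opp (hSu Mu hMu1 le_rfl) hnot'
              have hP'' : P (τ1, w.2 + Mu) := by rw [← hfc'']; exact hPiso i'' hi'' hsv'' hk''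
              have hle' : w.2 + Mu ≤ r.2 := by have := hY i'' hi''; rw [hfc''] at this; exact this
              rcases lt_or_eq_of_le hle' with hlt'' | heq'
              · have := hmidτ _ hP'' (by simp only; omega) hlt''
                have := congrArg Prod.snd this; simp only at this; omega
              · rcases hrowY _ hP'' heq' with e' | e' <;> (have := congrArg Prod.fst e'; simp only at this; omega)
            · exact absurd hs0 h0N
            · have := congrArg Prod.fst hZ; rw [hc1] at this; simp only at this; omega
      · exact absurd hs0 h0N
      · have := congrArg Prod.fst hZ; rw [hc1] at this; simp only at this; omega
  rcases hendu with ⟨hMu1, hnotτ⟩ | ⟨-, hs0⟩ | ⟨hZ, -⟩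
  rotate_left
  · exact absurd hs0 h0N
  · ------------------------------------------------------------ Z-CASE: `τ = (r.1, w.2)`, its chain climbs straight to the last plaquette: the walk ends before hitting `r`
    have eτ := congrArg Prod.fst hZ; have eMu := congrArg Prod.snd hZ; rw [hc1] at eτ eMu; simp only at eτ eMu
    -- `τ` is the first turn (the doubly-visited alternative puts the first turn at `(r.1, w.2) = τ`, which is singly visited)
    obtain ⟨hτk, -⟩ : τ1 = w.1 + k₁ ∧ ¬ω.2.UsesSide (w.1 + k₁, w.2) .E := by
      rcases hp₁ with hA' | ⟨e, hlt, -⟩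
      · exact hA'
      · exfalso; omega
    have eiτ : iτ = k₁ := (hsvτ k₁ hk₁ (by rw [hfk, hfcτ, hτk])).symm
    -- `τ`'s arc leaves through `N`
    have hτoutN : ω.2.sOut k₁ = .N := by
      obtain ⟨j, hj, hfj, hs⟩ := hτN
      have ej := hsvτ j hj (hfj.trans hfcτ.symm); rw [eiτ] at ej; subst ej
      rcases hs with hs | hs
      · rw [hWk] at hs; exact absurd hs (by decide)
      · exact hs
    -- the cells above `τ` up to the last plaquette carry only straight arcs
    have hcells : ∀ m : ℕ, 1 ≤ m → m ≤ Mu → ∀ i < n, ω.2.fc i = ((ω.2.fc k₁).1, (ω.2.fc k₁).2 + m) →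
        arcKind (ω.2.sIn i) (ω.2.sOut i) = .straight := by
      intro m hm1 hmM i hi hfi
      rw [hfk] at hfi; simp only at hfi
      have hNm : ω.2.UsesSide (w.1 + k₁, w.2 + m) .N := by
        rcases lt_or_eq_of_le hmM with hlt | rfl
        · have := hNu m hlt; simp only at this; rwa [hτk] at this
        · refine ⟨n - 1, by omega, ?_, Or.inr hsN⟩; rw [hc1]; simp only [Prod.mk.injEq]; constructor <;> omega
      have hSm : ω.2.UsesSide (w.1 + k₁, w.2 + m) .S := by have := hSu m hm1 hmM; simp only at this; rwa [hτk] at this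
      have hEm : ¬ω.2.UsesSide (w.1 + k₁, w.2 + m) .E := by
        intro hE
        obtain ⟨M, hWall, -, hend⟩ := ω.2.chain_E hX' hE
        rcases hend with ⟨hM1, hnot⟩ | ⟨-, hs0⟩ | ⟨-, hsZ⟩
        · obtain ⟨i', hi', hfc', hsv', -, -, -, hk'⟩ := ω.2.isolated_of_usesSide_not_opp (hWall M hM1 le_rfl) hnot
          have hP' : P (w.1 + k₁ + M, w.2 + m) := by rw [← hfc']; exact hPiso i' hi' hsv' hk'
          have := hmidτ _ hP' (by simp only; omega) (by simp only; omega)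
          have := congrArg Prod.snd this; simp only at this; omega
        · exact absurd hs0 h0E
        · exact absurd hsZ hzE
      exact ω.2.straight_of_usesSide_NS hNm hSm hEm i hi hfi
    -- run up: the arc `k₁ + Mu` lies in the last plaquette, so `k₁ + Mu = n − 1`
    have hcE : ¬ω.2.UsesSide (r.1, r.2 - 1) .E := by
      intro hE
      obtain ⟨M, hWall, -, hend⟩ := ω.2.chain_E hX' hE
      rcases hend with ⟨hM1, hnot⟩ | ⟨-, hs0⟩ | ⟨-, hsZ⟩
      · obtain ⟨i', hi', hfc', hsv', -, -, -, hk'⟩ := ω.2.isolated_of_usesSide_not_opp (hWall M hM1 le_rfl) hnot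
        have hP' : P (r.1 + M, r.2 - 1) := by rw [← hfc']; exact hPiso i' hi' hsv' hk'
        rcases lt_or_eq_of_le (show w.2 ≤ r.2 - 1 by omega) with hlt | heq
        · have := hmidτ _ hP' (by simp only; omega) (by simp only; omega)
          have := congrArg Prod.snd this; simp only at this; omega
        · -- `c` on the root row: then `Mu = 0`, i.e. `c = τ`, singly visited with an arc through `W` and `N` — not `E`
          have e0 : Mu = 0 := by omega
          have : ω.2.fc (n - 1) = ω.2.fc iτ := by rw [hc1, hfcτ, eτ, ← heq]
          have en := hsvτ (n - 1) (by omega) this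
          obtain ⟨j, hj, hfj, hjE⟩ := hE
          have := hsvτ j hj (by rw [hfj, hfcτ, eτ, heq])
          subst this
          rcases hjE with e | e
          · exact hninτ e
          · exact hnoutτ e
      · exact absurd hs0 h0E
      · exact absurd hsZ hzE
    have hrun_up := ω.2.run_up_of_straight (j := k₁) (M := min Mu (n - 1 - k₁)) (by omega) hτoutN
      (fun m hm1 hmM i hi hfi => hcells m hm1 (le_trans hmM (min_le_left _ _)) i hi hfi)
    have hkMu : k₁ + Mu = n - 1 := by
      rcases Nat.lt_or_ge (n - 1 - k₁) Mu with hlt | hge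
      · exfalso
        have hmin : min Mu (n - 1 - k₁) = n - 1 - k₁ := min_eq_right hlt.le
        obtain ⟨hfc', -⟩ := hrun_up (n - 1 - k₁) (by rw [hmin])
        rw [show k₁ + (n - 1 - k₁) = n - 1 by omega, hc1, hfk] at hfc'
        simp only [Prod.mk.injEq] at hfc'
        omega
      · have hmin : min Mu (n - 1 - k₁) = Mu := min_eq_left hge
        obtain ⟨hfc', -⟩ := hrun_up Mu (by rw [hmin])
        rw [hfk] at hfc'; simp only at hfc'
        have : ω.2.fc (k₁ + Mu) = ω.2.fc (n - 1) := by rw [hfc', hc1]; simp only [Prod.mk.injEq]; constructor <;> omega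
        exact ω.2.single_visit_of_not_usesSide hcE (by omega) (by omega) (this.trans hc1) hc1
    -- the first hit of `r` comes before `k₁`: it is on the root row
    have hfh : ω.2.firstHitG < k₁ := by
      by_contra hge
      push Not at hge
      have hle : ω.2.firstHitG - k₁ ≤ min Mu (n - 1 - k₁) := by
        rw [min_eq_left (by omega : Mu ≤ n - 1 - k₁)]; omega
      obtain ⟨hfc', -⟩ := hrun_up (ω.2.firstHitG - k₁) hle
      rw [show k₁ + (ω.2.firstHitG - k₁) = ω.2.firstHitG by omega, hfcF, hfk] at hfc'
      have := congrArg Prod.snd hfc'; simp only at this; omega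
    obtain ⟨hffh, -⟩ := hrun ω.2.firstHitG hfh.le
    rw [hfcF] at hffh
    have := congrArg Prod.snd hffh; simp only at this; omega
  · ------------------------------------------------------------ t₂-CASE: `τ = (r.1 + M₂, w.2)`; the plaquette `κ₀ = (r.1, w.2)` is the doubly visited first turn
    obtain ⟨iτ', hiτ', hfcτ', hsvτ', -, -, -, hkτ'⟩ := ω.2.isolated_of_usesSide_not_opp (hSu Mu hMu1 le_rfl) hnotτ
    have hPτ' : P (τ1, w.2 + Mu) := by have := hPiso iτ' hiτ' hsvτ' hkτ'; rw [hfcτ'] at this; simpa using this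
    have hτ1 : τ1 = r.1 + M₂ := by
      have hle : w.2 + Mu ≤ r.2 := by have := hY iτ' hiτ'; rw [hfcτ'] at this; simpa using this
      rcases lt_or_eq_of_le hle with hlt | heq
      · have := hmidτ _ hPτ' (by simp only; omega) hlt
        have := congrArg Prod.snd this; simp only at this; omega
      · rcases hrowY _ hPτ' heq with e | e
        · have := congrArg Prod.fst e; simp only at this; omega
        · have := congrArg Prod.fst e; simp only at this; exact this
    -- the root row from `w` to `τ`: every plaquette uses `E` and `W`
    obtain ⟨Mw, hEw, hWw, hendw⟩ := ω.2.chain_W hX hτW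
    have hMw : (Mw : ℤ) = τ1 - w.1 := by
      rcases hendw with ⟨hM1, hnot⟩ | ⟨hA0, -⟩ | ⟨-, hsZ⟩
      · exfalso
        obtain ⟨i', hi', hfc', hsv', -, -, -, hk'⟩ := ω.2.isolated_of_usesSide_not_opp (hEw Mw hM1 le_rfl) hnot
        have hP' : P (τ1 - Mw, w.2) := by rw [← hfc']; exact hPiso i' hi' hsv' hk'
        have := hmidτ _ hP' hY'w hYw
        have := congrArg Prod.fst this; simp only at this; omega
      · rw [h0w] at hA0; have := congrArg Prod.fst hA0; simp only at this; omega
      · exact absurd hsZ hzW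
    have hκE : ω.2.UsesSide (r.1, w.2) .E := by
      have := hEw M₂ hM₂1 (by omega); simp only at this
      rwa [show τ1 - (M₂ : ℤ) = r.1 by omega] at this
    have hκW : ω.2.UsesSide (r.1, w.2) .W := by
      rcases lt_or_eq_of_le hcol with hlt | heq
      · have := hWw M₂ (by omega); simp only at this
        rwa [show τ1 - (M₂ : ℤ) = r.1 by omega] at this
      · refine ⟨0, hlen, ?_, Or.inl h0W⟩; rw [h0w]; exact Prod.ext heq rfl
    -- the last plaquette `c = (r.1, r.2 − 1)` uses `S`
    have hcS : ω.2.UsesSide (r.1, r.2 - 1) .S := by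
      rcases lt_or_eq_of_le (show w.2 ≤ r.2 - 1 by omega) with hlt | heq
      · -- `c` strictly above the root row: its last arc cannot enter sideways (that chain would end at a middle turn)
        have hcE : ¬ω.2.UsesSide (r.1, r.2 - 1) .E := by
          intro hE
          obtain ⟨M, hWall, -, hend⟩ := ω.2.chain_E hX' hE
          rcases hend with ⟨hM1, hnot⟩ | ⟨-, hs0⟩ | ⟨-, hsZ⟩
          · obtain ⟨i', hi', hfc', hsv', -, -, -, hk'⟩ := ω.2.isolated_of_usesSide_not_opp (hWall M hM1 le_rfl) hnot
            have hP' : P (r.1 + M, r.2 - 1) := by rw [← hfc']; exact hPiso i' hi' hsv' hk'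
            have := hmidτ _ hP' (by simp only; omega) (by simp only; omega)
            have := congrArg Prod.snd this; simp only at this; omega
          · exact absurd hs0 h0E
          · exact absurd hsZ hzE
        have hcW : ¬ω.2.UsesSide (r.1, r.2 - 1) .W := by
          intro hW
          obtain ⟨M, hEall, -, hend⟩ := ω.2.chain_W hX hW
          rcases hend with ⟨hM1, hnot⟩ | ⟨hA0, -⟩ | ⟨-, hsZ⟩
          · obtain ⟨i', hi', hfc', hsv', -, -, -, hk'⟩ := ω.2.isolated_of_usesSide_not_opp (hEall M hM1 le_rfl) hnot
            have hP' : P (r.1 - M, r.2 - 1) := by rw [← hfc']; exact hPiso i' hi' hsv' hk'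
            have := hmidτ _ hP' (by simp only; omega) (by simp only; omega)
            have := congrArg Prod.snd this; simp only at this; omega
          · rw [h0w] at hA0; have := congrArg Prod.snd hA0; simp only at this; omega
          · exact absurd hsZ hzW
        have hne := ω.2.sIn_ne_sOut (show n - 1 < n by omega)
        rw [hsN] at hne
        have hS : ω.2.sIn (n - 1) = .S := by
          have h1 : ω.2.sIn (n - 1) ≠ .E := fun e => hcE ⟨n - 1, by omega, hc1, Or.inl e⟩
          have h2 : ω.2.sIn (n - 1) ≠ .W := fun e => hcW ⟨n - 1, by omega, hc1, Or.inl e⟩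
          revert hne h1 h2; cases ω.2.sIn (n - 1) <;> decide
        exact ⟨n - 1, by omega, hc1, Or.inl hS⟩
      · -- `c` on the root row is `κ₀`: three used sides `E`, `W`, `N` need two arcs
        rw [heq] at hκE hκW
        by_contra hS
        obtain ⟨j₁, hj₁, hf₁, hs₁⟩ := hκE
        obtain ⟨j₂, hj₂, hf₂, hs₂⟩ := hκW
        have e1 := ω.2.single_visit_of_not_usesSide hS hj₁ (show n - 1 < n by omega) hf₁ hc1
        have e2 := ω.2.single_visit_of_not_usesSide hS hj₂ (show n - 1 < n by omega) hf₂ hc1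
        subst e1; subst e2
        have hne := ω.2.sIn_ne_sOut (show n - 1 < n by omega)
        revert hs₁ hs₂ hne hsN
        cases ω.2.sIn (n - 1) <;> cases ω.2.sOut (n - 1) <;> decide
    -- its chain descends to the bottom-row turn `B_c = (r.1, Y')`
    obtain ⟨Mc, hNc, hSc, hendc⟩ := ω.2.chain_S hY' hcS
    obtain ⟨hMc, hBcN, hBcnS⟩ : (Mc : ℤ) = r.2 - 1 - Y' ∧ ω.2.UsesSide (r.1, Y') .N ∧ ¬ω.2.UsesSide (r.1, Y') .S := by
      rcases hendc with ⟨hM1, hnot⟩ | ⟨-, hs0⟩ | ⟨-, hsZ⟩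
      · obtain ⟨i', hi', hfc', hsv', -, -, -, hk'⟩ := ω.2.isolated_of_usesSide_not_opp (hNc Mc hM1 le_rfl) hnot
        have hP' : P (r.1, r.2 - 1 - Mc) := by rw [← hfc']; exact hPiso i' hi' hsv' hk'
        have hge : Y' ≤ r.2 - 1 - Mc := by have := hY' i' hi'; rw [hfc'] at this; exact this
        rcases lt_or_eq_of_le hge with hlt | heq
        · have := hmidτ _ hP' hlt (by simp only; omega)
          have := congrArg Prod.fst this; simp only at this; omega
        · have eY : r.2 - 1 - (Mc : ℤ) = Y' := heq.symm
          simp only at hnot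
          refine ⟨by omega, ?_, ?_⟩
          · have := hNc Mc hM1 le_rfl; simp only at this; rwa [eY] at this
          · rwa [eY] at hnot
      · exact absurd hs0 h0S
      · rw [hsN] at hsZ; exact absurd hsZ (by decide)
    obtain ⟨iBc, hiBc, hfcBc, hsvBc, hNBc, hninBc, hnoutBc, hkBc⟩ := ω.2.isolated_of_usesSide_not_opp hBcN hBcnS
    have hPBc : P (r.1, Y') := by rw [← hfcBc]; exact hPiso iBc hiBc hsvBc hkBc
    -- every bottom-row isolated turn is `B₁ = (X, Y')` or `B_c`
    have hrowY' : ∀ f, P f → f.2 = Y' → f = ((X : ℤ), Y') ∨ f = (r.1, Y') := by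
      intro f hf hf2
      by_contra hno
      push Not at hno
      exact (hrow3 _ _ _ hPB₁ hPBc hf (by intro e; have := congrArg Prod.fst e; simp only at this; omega) (Ne.symm hno.1) (Ne.symm hno.2)).2
        ⟨rfl, rfl, hf2⟩
    -- `κ₀ = (r.1, w.2)` uses `N` and `S`
    have hκN : ω.2.UsesSide (r.1, w.2) .N := by
      rcases lt_or_eq_of_le (show w.2 ≤ r.2 - 1 by omega) with hlt | heq
      · have := hNc (r.2 - 1 - w.2).toNat (by omega) (by omega); simp only at this
        rwa [show r.2 - 1 - (((r.2 - 1 - w.2).toNat : ℕ) : ℤ) = w.2 by omega] at this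
      · refine ⟨n - 1, by omega, by rw [hc1, heq], Or.inr hsN⟩
    have hκS : ω.2.UsesSide (r.1, w.2) .S := by
      have := hSc (r.2 - 1 - w.2).toNat (by omega); simp only at this
      rwa [show r.2 - 1 - (((r.2 - 1 - w.2).toNat : ℕ) : ℤ) = w.2 by omega] at this
    -- the first turn is at `κ₀`
    obtain ⟨hk₁r, -, hp2⟩ : w.1 + (k₁ : ℤ) = r.1 ∧ w.1 + k₁ < τ1 ∧ ∀ s, ω.2.UsesSide (w.1 + k₁, w.2) s := by
      rcases hp₁ with ⟨hτk, -⟩ | hB'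
      · -- `τ = p₁`: the initial run crosses `κ₀` with a straight arc, but `κ₀` uses `N`
        exfalso
        have hm₀ : (r.1 - w.1).toNat < k₁ := by omega
        obtain ⟨hfm, hWm⟩ := hrun (r.1 - w.1).toNat hm₀.le
        have hsm := hstr _ hm₀
        have hout := ω.2.sOut_of_straight (show (r.1 - w.1).toNat < n by omega) hsm
        obtain ⟨j, hj, hfj, hs⟩ := hκN
        have hfj' : ω.2.fc j = ω.2.fc (r.1 - w.1).toNat := by
          rw [hfj, hfm]; exact Prod.ext (by simp only; omega) rfl
        have ej : j = (r.1 - w.1).toNat := by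
          by_contra hne
          exact (ω.2.not_straight_of_two_arcs (show (r.1 - w.1).toNat < n by omega) hj (Ne.symm hne) hfj').1 hout
        rw [ej, hWm] at hs
        rw [hWm] at hout
        rcases hs with hs | hs
        · exact absurd hs (by decide)
        · rw [hout] at hs; exact absurd hs (by decide)
      · exact hB'
    have hfk' : ω.2.fc k₁ = (r.1, w.2) := by rw [hfk]; exact Prod.ext hk₁r rfl
    have hsv_c : ∀ i j, i < n → j < n → ω.2.fc i = (r.1, r.2 - 1) → ω.2.fc j = (r.1, r.2 - 1) → w.2 < r.2 - 1 → i = j := by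
      -- above the root row `c` does not use `E`
      intro i j hi hj hfi hfj hlt
      have hcE : ¬ω.2.UsesSide (r.1, r.2 - 1) .E := by
        intro hE
        obtain ⟨M, hWall, -, hend⟩ := ω.2.chain_E hX' hE
        rcases hend with ⟨hM1, hnot⟩ | ⟨-, hs0⟩ | ⟨-, hsZ⟩
        · obtain ⟨i', hi', hfc', hsv', -, -, -, hk'⟩ := ω.2.isolated_of_usesSide_not_opp (hWall M hM1 le_rfl) hnot
          have hP' : P (r.1 + M, r.2 - 1) := by rw [← hfc']; exact hPiso i' hi' hsv' hk'
          have := hmidτ _ hP' (by simp only; omega) (by simp only; omega)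
          have := congrArg Prod.snd this; simp only at this; omega
        · exact absurd hs0 h0E
        · exact absurd hsZ hzE
      exact ω.2.single_visit_of_not_usesSide hcE hi hj hfi hfj
    -- middle-row cells of column `r.1` other than `κ₀` carry only straight arcs (no `E` side used)
    have hnoE : ∀ y : ℤ, Y' < y → y < r.2 → y ≠ w.2 → ¬ω.2.UsesSide (r.1, y) .E := by
      intro y h1 h2 h3 hE
      obtain ⟨M, hWall, -, hend⟩ := ω.2.chain_E hX' hE
      rcases hend with ⟨hM1, hnot⟩ | ⟨-, hs0⟩ | ⟨-, hsZ⟩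
      · obtain ⟨i', hi', hfc', hsv', -, -, -, hk'⟩ := ω.2.isolated_of_usesSide_not_opp (hWall M hM1 le_rfl) hnot
        have hP' : P (r.1 + M, y) := by rw [← hfc']; exact hPiso i' hi' hsv' hk'
        have := hmidτ _ hP' h1 h2
        have := congrArg Prod.snd this; simp only at this; omega
      · exact absurd hs0 h0E
      · exact absurd hsZ hzE
    have hNS_col : ∀ m : ℕ, 1 ≤ m → (m : ℤ) ≤ r.2 - 1 - Y' → ω.2.UsesSide (r.1, r.2 - 1 - m) .N ∧ ((m : ℤ) < r.2 - 1 - Y' → ω.2.UsesSide (r.1, r.2 - 1 - m) .S) := by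
      intro m hm1 hmM
      refine ⟨?_, fun hlt => ?_⟩
      · have := hNc m hm1 (by omega); simpa using this
      · have := hSc m (by omega); simpa using this
    -- the first arc at `κ₀` turns `N` or `S`
    have hk₁NS : ω.2.sOut k₁ = .N ∨ ω.2.sOut k₁ = .S := by
      have hne := ω.2.sIn_ne_sOut hk₁
      have hk := hturn
      rw [hWk] at hne hk
      revert hne hk; cases ω.2.sOut k₁ <;> decide
    rcases hk₁NS with hk₁N | hk₁S
    · ---------------------------------------------------------- first arc `W → N`: the walk climbs straight to the last plaquette and ends before hitting `r`
      rcases lt_or_eq_of_le (show w.2 ≤ r.2 - 1 by omega) with hlt | heq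
      swap
      · -- `c = κ₀`: the first arc already leaves through `z`
        obtain ⟨-, hout⟩ := ω.2.side_sIn_eq_nth hk₁
        rw [hk₁N, hfk'] at hout
        have ez : Face.side ((r.1, w.2) : Face) .N = ω.2.nth n := by
          rw [ω.2.nth_length, hωS]; obtain ⟨r1, r2⟩ := r; simp only [Face.side, MidEdge.slant.injEq, true_and] at heq ⊢; omega
        have := ω.2.nth_inj (show k₁ + 1 ≤ n by omega) le_rfl (hout.symm.trans ez)
        obtain ⟨hffh, -⟩ := hrun ω.2.firstHitG (by omega)
        rw [hfcF] at hffh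
        have := congrArg Prod.snd hffh; simp only at this; omega
      set Mz := (r.2 - 1 - w.2).toNat with hMz
      have hcells : ∀ m : ℕ, 1 ≤ m → m ≤ Mz → ∀ i < n, ω.2.fc i = ((ω.2.fc k₁).1, (ω.2.fc k₁).2 + m) →
          arcKind (ω.2.sIn i) (ω.2.sOut i) = .straight := by
        intro m hm1 hmM i hi hfi
        rw [hfk'] at hfi; simp only at hfi
        rcases Nat.lt_or_ge m Mz with hlt' | hge
        · obtain ⟨hNm, hSm⟩ := hNS_col (Mz - m) (by omega) (by omega)
          have e : r.2 - 1 - ((Mz - m : ℕ) : ℤ) = w.2 + m := by omega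
          rw [e] at hNm hSm
          exact ω.2.straight_of_usesSide_NS hNm (hSm (by omega)) (hnoE _ (by omega) (by omega) (by omega)) i hi hfi
        · -- `m = Mz`: the cell is `c`, which uses `N` by the last arc and `S` by `hcS`
          have ec : ((r.1 : ℤ), w.2 + (m : ℤ)) = (r.1, r.2 - 1) := Prod.ext rfl (by simp only; omega)
          rw [ec] at hfi
          exact ω.2.straight_of_usesSide_NS ⟨n - 1, by omega, hc1, Or.inr hsN⟩ hcS (hnoE _ (by omega) (by omega) (by omega)) i hi hfi
      have hrunM : ∀ M : ℕ, M ≤ Mz → k₁ + M < n → ∀ m ≤ M, ω.2.fc (k₁ + m) = (r.1, w.2 + m) ∧ ω.2.sOut (k₁ + m) = .N := by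
        intro M hM hMn m hm
        obtain ⟨h1, h2⟩ := ω.2.run_up_of_straight (j := k₁) (M := M) hMn hk₁N
          (fun m' hm1 hm' i hi hfi => hcells m' hm1 (le_trans hm' hM) i hi hfi) m hm
        refine ⟨?_, h2⟩
        rw [h1, hfk']
      have hkMz : k₁ + Mz = n - 1 := by
        by_contra hne
        rcases Nat.lt_or_ge (k₁ + Mz) (n - 1) with hlt' | hge'
        · obtain ⟨h1, -⟩ := hrunM Mz le_rfl (by omega) Mz le_rfl
          have e : ω.2.fc (k₁ + Mz) = (r.1, r.2 - 1) := by rw [h1]; exact Prod.ext rfl (by simp only; omega)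
          have := hsv_c _ _ (by omega) (by omega) e hc1 hlt
          omega
        · obtain ⟨h1, -⟩ := hrunM (n - 1 - k₁) (by omega) (by omega) (n - 1 - k₁) le_rfl
          rw [show k₁ + (n - 1 - k₁) = n - 1 by omega, hc1] at h1
          have := congrArg Prod.snd h1; simp only at this; omega
      have hfh : ω.2.firstHitG < k₁ := by
        by_contra hge
        push Not at hge
        obtain ⟨h1, -⟩ := hrunM Mz le_rfl (by omega) (ω.2.firstHitG - k₁) (by omega)
        rw [show k₁ + (ω.2.firstHitG - k₁) = ω.2.firstHitG by omega, hfcF] at h1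
        have := congrArg Prod.snd h1; simp only at this; omega
      obtain ⟨hffh, -⟩ := hrun ω.2.firstHitG hfh.le
      rw [hfcF] at hffh
      have := congrArg Prod.snd hffh; simp only at this; omega
    · ---------------------------------------------------------- first arc `W → S`: the forced itinerary κ₀ → B_c → B₁ → T₁ → r; the excursion never crosses the western ray
      have hupN : ∀ f : Face, f.2 = r.2 → ¬ω.2.UsesSide f .N := by
        rintro f hf ⟨i, hi, hfi, hs | hs⟩
        · exact (hNtop i hi (by rw [hfi, hf])).1 hs
        · exact (hNtop i hi (by rw [hfi, hf])).2 hs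
      have hbotS : ∀ f : Face, f.2 = Y' → ¬ω.2.UsesSide f .S := by
        rintro f hf ⟨i, hi, hfi, hs | hs⟩
        · exact (hSbot i hi (by rw [hfi, hf])).1 hs
        · exact (hSbot i hi (by rw [hfi, hf])).2 hs
      have hleftW : ∀ f : Face, f.1 = X → ¬ω.2.UsesSide f .W := by
        rintro f hf ⟨i, hi, hfi, hs | hs⟩
        · exact (hWleft i hi (by rw [hfi, hf])).1 hs
        · exact (hWleft i hi (by rw [hfi, hf])).2 hs
      -- (1) down the column `r.1` from `κ₀` to `B_c`
      set Md := (w.2 - 1 - Y').toNat with hMd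
      have hcellsD : ∀ m : ℕ, 1 ≤ m → m ≤ Md → ∀ i < n, ω.2.fc i = ((ω.2.fc k₁).1, (ω.2.fc k₁).2 - m) →
          arcKind (ω.2.sIn i) (ω.2.sOut i) = .straight := by
        intro m hm1 hmM i hi hfi
        rw [hfk'] at hfi; simp only at hfi
        obtain ⟨hNm, hSm⟩ := hNS_col ((r.2 - 1 - w.2).toNat + m) (by omega) (by omega)
        have e : r.2 - 1 - (((r.2 - 1 - w.2).toNat + m : ℕ) : ℤ) = w.2 - m := by omega
        rw [e] at hNm hSm
        exact ω.2.straight_of_usesSide_NS hNm (hSm (by omega)) (hnoE _ (by omega) (by omega) (by omega)) i hi hfi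
      have hrunD : ∀ M : ℕ, M ≤ Md → k₁ + M < n → ∀ m ≤ M, ω.2.fc (k₁ + m) = (r.1, w.2 - m) ∧ ω.2.sOut (k₁ + m) = .S := by
        intro M hM hMn m hm
        obtain ⟨h1, h2⟩ := ω.2.run_down_of_straight (j := k₁) (M := M) hMn hk₁S
          (fun m' hm1 hm' i hi hfi => hcellsD m' hm1 (le_trans hm' hM) i hi hfi) m hm
        exact ⟨by rw [h1, hfk'], h2⟩
      have hkMd : k₁ + Md + 1 < n := by
        by_contra hge
        obtain ⟨-, h2⟩ := hrunD (n - 1 - k₁) (by omega) (by omega) (n - 1 - k₁) le_rfl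
        rw [show k₁ + (n - 1 - k₁) = n - 1 by omega, hsN] at h2
        exact absurd h2 (by decide)
      obtain ⟨hDlast, hDout⟩ := hrunD Md le_rfl (by omega) Md le_rfl
      -- the arc `jB = k₁ + Md + 1` lies in `B_c`, entered from `N`, and leaves through `W`
      have hfcjB := ω.2.fc_succ_eq_of_sOut_S hkMd hDout
      rw [hDlast] at hfcjB
      have hfcjB' : ω.2.fc (k₁ + Md + 1) = (r.1, Y') := by rw [hfcjB]; exact Prod.ext rfl (by simp only; omega)
      have hinjB : ω.2.sIn (k₁ + Md + 1) = .N := sIn_succ_of_sOut_S ω.2 hkMd hDout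
      have hBcE : ¬ω.2.UsesSide (r.1, Y') .E := by
        intro hE
        obtain ⟨M, hWall, -, hend⟩ := ω.2.chain_E hX' hE
        rcases hend with ⟨hM1, hnot⟩ | ⟨-, hs0⟩ | ⟨-, hsZ⟩
        · obtain ⟨i', hi', hfc', hsv', -, -, -, hk'⟩ := ω.2.isolated_of_usesSide_not_opp (hWall M hM1 le_rfl) hnot
          have hP' : P (r.1 + M, Y') := by rw [← hfc']; exact hPiso i' hi' hsv' hk'
          rcases hrowY' _ hP' rfl with e | e
          · have := congrArg Prod.fst e; simp only at this; omega
          · have := congrArg Prod.fst e; simp only at this; omega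
        · exact absurd hs0 h0E
        · exact absurd hsZ hzE
      have hjBW : ω.2.sOut (k₁ + Md + 1) = .W := by
        have hne := ω.2.sIn_ne_sOut hkMd
        rw [hinjB] at hne
        have h1 : ω.2.sOut (k₁ + Md + 1) ≠ .S := fun e => hBcnS ⟨_, hkMd, hfcjB', Or.inr e⟩
        have h2 : ω.2.sOut (k₁ + Md + 1) ≠ .E := fun e => hBcE ⟨_, hkMd, hfcjB', Or.inr e⟩
        revert hne h1 h2; cases ω.2.sOut (k₁ + Md + 1) <;> decide
      -- (2) west along the bottom row from `B_c` to `B₁`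
      obtain ⟨Mb, hEb, hWb, hendb⟩ := ω.2.chain_W hX ⟨_, hkMd, hfcjB', Or.inr hjBW⟩
      have hMb : (Mb : ℤ) = r.1 - X := by
        rcases hendb with ⟨hM1, hnot⟩ | ⟨hA0, -⟩ | ⟨-, hsZ⟩
        · obtain ⟨i', hi', hfc', hsv', -, -, -, hk'⟩ := ω.2.isolated_of_usesSide_not_opp (hEb Mb hM1 le_rfl) hnot
          have hP' : P (r.1 - Mb, Y') := by rw [← hfc']; exact hPiso i' hi' hsv' hk'
          rcases hrowY' _ hP' rfl with e | e
          · have := congrArg Prod.fst e; simp only at this; omega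
          · have := congrArg Prod.fst e; simp only at this; omega
        · rw [h0w] at hA0; have := congrArg Prod.snd hA0; simp only at this; omega
        · exact absurd hsZ hzW
      set Mw' := (r.1 - X - 1).toNat with hMw'
      have hcellsW : ∀ m : ℕ, 1 ≤ m → m ≤ Mw' → ∀ i < n,
          ω.2.fc i = ((ω.2.fc (k₁ + Md + 1)).1 - m, (ω.2.fc (k₁ + Md + 1)).2) → arcKind (ω.2.sIn i) (ω.2.sOut i) = .straight := by
        intro m hm1 hmM i hi hfi
        rw [hfcjB'] at hfi; simp only at hfi
        exact ω.2.straight_of_usesSide_EW (hEb m hm1 (by omega)) (hWb m (by omega)) (hbotS _ rfl) i hi hfi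
      have hrunW : ∀ M : ℕ, M ≤ Mw' → k₁ + Md + 1 + M < n → ∀ m ≤ M,
          ω.2.fc (k₁ + Md + 1 + m) = (r.1 - m, Y') ∧ ω.2.sOut (k₁ + Md + 1 + m) = .W := by
        intro M hM hMn m hm
        obtain ⟨h1, h2⟩ := ω.2.run_west_of_straight (j := k₁ + Md + 1) (M := M) hMn hjBW
          (fun m' hm1 hm' i hi hfi => hcellsW m' hm1 (le_trans hm' hM) i hi hfi) m hm
        exact ⟨by rw [h1, hfcjB'], h2⟩
      have hkMw : k₁ + Md + 1 + Mw' + 1 < n := by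
        by_contra hge
        obtain ⟨h1, -⟩ := hrunW (n - 1 - (k₁ + Md + 1)) (by omega) (by omega) _ le_rfl
        rw [show k₁ + Md + 1 + (n - 1 - (k₁ + Md + 1)) = n - 1 by omega, hc1] at h1
        have := congrArg Prod.snd h1; simp only at this; omega
      obtain ⟨hWlast, hWout⟩ := hrunW Mw' le_rfl (by omega) Mw' le_rfl
      obtain ⟨hfcj₁, hinj₁⟩ := ω.2.fc_succ_eq_of_sOut_W hkMw hWout
      rw [hWlast] at hfcj₁
      have hfcj₁' : ω.2.fc (k₁ + Md + 1 + Mw' + 1) = (X, Y') := by rw [hfcj₁]; exact Prod.ext (by simp only; omega) rfl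
      set j₁ := k₁ + Md + 1 + Mw' + 1 with hj₁
      have hj₁n : j₁ < n := hkMw
      have hj₁N : ω.2.sOut j₁ = .N := by
        have hne := ω.2.sIn_ne_sOut hj₁n
        rw [hinj₁] at hne
        have h1 : ω.2.sOut j₁ ≠ .S := fun e => hB₁S ⟨_, hj₁n, hfcj₁', Or.inr e⟩
        have h2 : ω.2.sOut j₁ ≠ .W := (hWleft j₁ hj₁n (by rw [hfcj₁'])).2
        revert hne h1 h2; cases ω.2.sOut j₁ <;> decide
      -- (3) up the column `X` from `B₁` through `(X, w.2)` to `T₁`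
      set Mu' := (r.2 - Y' - 1).toNat with hMu'
      have hcellsU : ∀ m : ℕ, 1 ≤ m → m ≤ Mu' → ∀ i < n, ω.2.fc i = ((ω.2.fc j₁).1, (ω.2.fc j₁).2 + m) →
          arcKind (ω.2.sIn i) (ω.2.sOut i) = .straight := by
        intro m hm1 hmM i hi hfi
        rw [hfcj₁'] at hfi; simp only at hfi
        have hN' := hNd₁ (Md₁ - m) (by omega) (by omega)
        have hS' := hSd₁ (Md₁ - m) (by omega)
        have e : r.2 - ((Md₁ - m : ℕ) : ℤ) = Y' + m := by omega
        rw [hT₁X, e] at hN' hS'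
        exact ω.2.straight_of_usesSide_NS hN' hS' (hleftW _ rfl) i hi hfi
      have hrunU : ∀ M : ℕ, M ≤ Mu' → j₁ + M < n → ∀ m ≤ M, ω.2.fc (j₁ + m) = (X, Y' + m) ∧ ω.2.sOut (j₁ + m) = .N := by
        intro M hM hMn m hm
        obtain ⟨h1, h2⟩ := ω.2.run_up_of_straight (j := j₁) (M := M) hMn hj₁N
          (fun m' hm1 hm' i hi hfi => hcellsU m' hm1 (le_trans hm' hM) i hi hfi) m hm
        exact ⟨by rw [h1, hfcj₁'], h2⟩
      have hkMu : j₁ + Mu' + 1 < n := by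
        by_contra hge
        obtain ⟨h1, -⟩ := hrunU (n - 1 - j₁) (by omega) (by omega) _ le_rfl
        rw [show j₁ + (n - 1 - j₁) = n - 1 by omega, hc1] at h1
        have := congrArg Prod.fst h1; simp only at this; omega
      obtain ⟨hUlast, hUout⟩ := hrunU Mu' le_rfl (by omega) Mu' le_rfl
      -- the plaquette `(X, w.2)` is crossed at the index `i_X = j₁ + (w.2 − Y')` by a straight arc
      obtain ⟨hfciX, -⟩ := hrunU Mu' le_rfl (by omega) (w.2 - Y').toNat (by omega)
      have hfciX' : ω.2.fc (j₁ + (w.2 - Y').toNat) = (X, w.2) := by rw [hfciX]; exact Prod.ext rfl (by simp only; omega)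
      have hstriX : arcKind (ω.2.sIn (j₁ + (w.2 - Y').toNat)) (ω.2.sOut (j₁ + (w.2 - Y').toNat)) = .straight :=
        hcellsU (w.2 - Y').toNat (by omega) (by omega) _ (by omega) (by rw [hfciX', hfcj₁']; exact Prod.ext rfl (by simp only; omega))
      -- the arc at `T₁ = (X, r.2)`, entered from `S`, leaves through `E`
      have hfcjT := ω.2.fc_succ_eq_of_sOut_N hkMu hUout
      rw [hUlast] at hfcjT
      have hfcjT' : ω.2.fc (j₁ + Mu' + 1) = (X, r.2) := by rw [hfcjT]; exact Prod.ext rfl (by simp only; omega)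
      have hinjT : ω.2.sIn (j₁ + Mu' + 1) = .S := sIn_succ_of_sOut_N ω.2 hkMu hUout
      set jT := j₁ + Mu' + 1 with hjT
      have hjTn : jT < n := hkMu
      have hjTE : ω.2.sOut jT = .E := by
        have hne := ω.2.sIn_ne_sOut hjTn
        rw [hinjT] at hne
        have h1 : ω.2.sOut jT ≠ .N := (hNtop jT hjTn (by rw [hfcjT'])).2
        have h2 : ω.2.sOut jT ≠ .W := (hWleft jT hjTn (by rw [hfcjT'])).2
        revert hne h1 h2; cases ω.2.sOut jT <;> decide
      -- (4) east along the top row from `T₁` to `r`: hence `firstHitG = jT + M₁ > i_X`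
      have hcellsE : ∀ m : ℕ, 1 ≤ m → m ≤ M₁ - 1 → ∀ i < n, ω.2.fc i = ((ω.2.fc jT).1 + m, (ω.2.fc jT).2) →
          arcKind (ω.2.sIn i) (ω.2.sOut i) = .straight := by
        intro m hm1 hmM i hi hfi
        rw [hfcjT'] at hfi; simp only at hfi
        have hE' := hE₁ (M₁ - m) (by omega) (by omega)
        have hW' := hW₁ (M₁ - m) (by omega)
        have e : r.1 - ((M₁ - m : ℕ) : ℤ) = X + m := by omega
        rw [e] at hE' hW'
        exact ω.2.straight_of_usesSide_EW hE' hW' (hupN _ rfl) i hi hfi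
      have hrunE : ∀ M : ℕ, M ≤ M₁ - 1 → jT + M < n → ∀ m ≤ M, ω.2.fc (jT + m) = (X + m, r.2) ∧ ω.2.sOut (jT + m) = .E := by
        intro M hM hMn m hm
        obtain ⟨h1, h2⟩ := ω.2.run_east_of_straight (j := jT) (M := M) hMn hjTE
          (fun m' hm1 hm' i hi hfi => hcellsE m' hm1 (le_trans hm' hM) i hi hfi) m hm
        exact ⟨by rw [h1, hfcjT'], h2⟩
      have hkME : jT + (M₁ - 1) + 1 < n := by
        by_contra hge
        obtain ⟨h1, -⟩ := hrunE (n - 1 - jT) (by omega) (by omega) _ le_rfl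
        rw [show jT + (n - 1 - jT) = n - 1 by omega, hc1] at h1
        have := congrArg Prod.snd h1; simp only at this; omega
      obtain ⟨hElast, hEout⟩ := hrunE (M₁ - 1) le_rfl (by omega) _ le_rfl
      obtain ⟨hfcjr, -⟩ := ω.2.fc_succ_eq_of_sOut_E hkME hEout
      rw [hElast] at hfcjr
      have hfcjr' : ω.2.fc (jT + (M₁ - 1) + 1) = r := by rw [hfcjr]; exact Prod.ext (by simp only; omega) rfl
      have hfh : jT + (M₁ - 1) + 1 = ω.2.firstHitG := hsvr _ hkME (hfcjr'.trans hfcF.symm)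
      have hiX_lt : j₁ + (w.2 - Y').toNat < ω.2.firstHitG := by rw [← hfh]; omega
      -- (5) parity: the western ray behind `w` is crossed by the excursion at a plaquette `(x₀, w.2)` through its `S` side
      have hodd := (ω.AJ_root_ne_zero_iff_odd_rayCountAt (hr := hr) h (b := w) (τ := .W) rfl).1 hA
      obtain ⟨j, hj, m, he⟩ := ω.exists_exit_eq_rayMid_of_odd hr h hodd
      rw [rayMid_W_eq, side_jOut h hj] at he
      have hMvn : ω.2.firstHitG + ω.Mv = n := fh_add_Mv h
      obtain ⟨i', hi'F, hi'n, hfci', hSi'⟩ : ∃ i', ω.2.firstHitG ≤ i' ∧ i' < n ∧ ω.2.fc i' = (w.1 - 1 - m, w.2) ∧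
          (ω.2.sIn i' = .S ∨ ω.2.sOut i' = .S) := by
        have hi : ω.2.firstHitG + j < n := by omega
        obtain ⟨-, hout⟩ := ω.2.side_sIn_eq_nth hi
        rw [he] at hout
        rcases eq_of_side_eq_slant hout with ⟨hf1, hs1⟩ | ⟨hf1, hs1⟩
        · exact ⟨_, by omega, hi, hf1, Or.inr hs1⟩
        · by_cases hlast : ω.2.firstHitG + j + 1 < n
          · have hf2 := ω.2.fc_succ_eq_of_sOut_N hlast hs1
            rw [hf1] at hf2
            exact ⟨_, by omega, hlast, by rw [hf2]; exact Prod.ext rfl (by simp only; omega),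
              Or.inl (sIn_succ_of_sOut_N ω.2 hlast hs1)⟩
          · exfalso
            have hlen1 : ω.2.firstHitG + j + 1 = n := by omega
            have hz' : ω.2.nth n = r.side ω.1 := ω.2.nth_length
            rw [← hlen1, he, hωS] at hz'
            obtain ⟨r1, r2⟩ := r
            simp only [Face.side, MidEdge.slant.injEq] at hz' hYw
            omega
      have hD' : ((w.1 - 1 - (m : ℤ), w.2) : Face) ∈ D := by rw [← hfci']; exact (YBWalk.arcFace_arcAt hi'n).2
      have hm1 : 1 ≤ m := by
        by_contra hlt
        have e0 : m = 0 := by omega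
        refine hh ?_
        have e : holeFaceW w = (w.1 - 1 - ((m : ℕ) : ℤ), w.2) := by rw [e0]; simp [holeFaceW]
        rw [e]; exact hD'
      obtain ⟨Mx, hNx, -, hendx⟩ := ω.2.chain_S hY' ⟨i', hi'n, hfci', hSi'⟩
      have hx₀ : w.1 - 1 - (m : ℤ) = X := by
        rcases hendx with ⟨hM1, hnot⟩ | ⟨-, hs0⟩ | ⟨-, hsZ⟩
        · obtain ⟨i'', hi'', hfc'', hsv'', -, -, -, hk''⟩ := ω.2.isolated_of_usesSide_not_opp (hNx Mx hM1 le_rfl) hnot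
          have hP' : P (w.1 - 1 - m, w.2 - Mx) := by rw [← hfc'']; exact hPiso i'' hi'' hsv'' hk''
          have hge : Y' ≤ w.2 - Mx := by have := hY' i'' hi''; rw [hfc''] at this; exact this
          rcases lt_or_eq_of_le hge with hlt | heq
          · have := hmidτ _ hP' hlt (by simp only; omega)
            have := congrArg Prod.fst this; simp only at this; omega
          · rcases hrowY' _ hP' heq.symm with e | e
            · have := congrArg Prod.fst e; simp only at this; exact this
            · have := congrArg Prod.fst e; simp only at this; omega
        · exact absurd hs0 h0S
        · rw [hsN] at hsZ; exact absurd hsZ (by decide)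
      -- so the crossing arc is the straight arc at `(X, w.2)`, whose index is `< firstHitG ≤ i'`
      rw [hx₀] at hfci'
      exact (ω.2.not_straight_of_two_arcs (show j₁ + (w.2 - Y').toNat < n by omega) hi'n (by omega)
        (hfci'.trans hfciX'.symm)).1 (ω.2.sOut_of_straight (show j₁ + (w.2 - Y').toNat < n by omega) hstriX)

end ΩG

end Literature.Probability.RandomPlanarGeometry.SAW.YangBaxter
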